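import Summits.QuantumFields.YangMills.Theorems.ConvexGribovBodyBrascampLiebVacuumSCStubGaugeAlgebra
import Literature.MathematicalPhysics.QuantumFieldTheory.StrongCouplingActivities
import Literature.MathematicalPhysics.QuantumLattice.GaugeGroups

/-!
# Crux `BrascampLiebVacuumSC` (stmt-QuantumFields-16404), line `SketchIdeator1`, skeleton v5:
# the cube witness from a Haar dimension gap (`stub_cubeWitness_of_dimensionGap`)

Helper file of the line lead c3 (`prover-line-stmt-QuantumFields-16404-c3-0`). Skeleton v5
(`Cruxes/BrascampLiebVacuumSC/Lines/SketchIdeator1.lean`) derives the volume-uniform Coulomb-gauge floor of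
the crux from ONE property of the compact group `G` alone, the registered stub `stub_cubeWitness`: for some
`n`, some configuration `u` of the `n × n × n` cube (sites `Fin 3 → Fin n`, links `(x, j)` with `x j + 1 < n`,
from `x` to `x + e_j`) is not a gauge transform of an involution-valued configuration. It is true for every
simply-connected compact simple Lie group by a dimension count, but the tree's abstract
`IsCompactSimpleLieGroup` carries no Lie structure. This file reduces it, sorry-free and WITHOUT nets, charts
or classification, to a HAAR DIMENSION GAP of the pair `(G, ρ)` stated with the tree's vocabulary only
(Haar probability measure, squared Frobenius distance `froSq` pulled back by the faithful unitary `ρ`):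

* (ball growth) `c ε^d ≤ μ{g : ‖ρ g − 1‖_F < ε}` for `0 < ε ≤ ε₀`;
* (thin involutions) `μ{g : ∃ j, j² = 1, ‖ρ g − ρ j‖_F < ε} ≤ C ε^m` for `0 < ε ≤ ε₀`;
* `d < 3 m`.

(For a compact Lie group `d = dim G` and `m = dim G − dim J_max`, `J_max` the largest conjugacy class of
involutions, so `d < 3m` says `dim J_max < (2/3) dim G`; for simply-connected compact simple `G` one has
`dim J_max ≤ (4/7) dim G`.)

## The argument (Tonelli volume counting, `DimensionGap.measure_pow_le_of_gaugeSaturation`)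

Let `V` be the cube sites, `Λ` its valid links, `μ` Haar probability on `G`, `A = {‖ρ a − 1‖ < ε/2}`,
`J = {j² = 1}` and `J_ε` its `ε`-thickening. If EVERY `w : Λ → G` is `k₀ • J`-valued for some gauge `k₀ : V → G`,
consider the open set `T = {(k, w) : ∀ ℓ, k(src ℓ) w_ℓ k(tgt ℓ)⁻¹ ∈ J_ε} ⊆ G^V × G^E`. Fibrewise in `k`, its
`μ^Λ`-measure is `μ(J_ε)^{|Λ|}` (two-sided invariance of `μ`), so `(μ^V ⊗ μ^Λ)(T) = μ(J_ε)^{|Λ|}`; fibrewise in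
`w`, it contains the product of balls `{k : k(x) k₀(x)⁻¹ ∈ A ∀x}` (bi-invariance of the Frobenius distance:
`‖ρ(a j b⁻¹) − ρ j‖ < ε` for `a, b ∈ A`), of `μ^V`-measure `μ(A)^{|V|}`. Hence `μ(A)^{|V|} ≤ μ(J_ε)^{|Λ|}`, i.e.
`(c (ε/2)^d)^{n³} ≤ (C ε^m)^{3n²(n−1)}` for all small `ε`, which is absurd for `n (3m − d) > 3m` as `ε → 0`.
Everything is proved; no named facts.
-/

set_option autoImplicit false

open scoped BigOperators Topology Matrix ENNReal
open Filter MeasureTheory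
open Literature.MathematicalPhysics.QuantumFieldTheory
open Summit.QuantumFields.YangMills.Cruxes.CovarianceBound.SupportWindow (froSq)

noncomputable section

namespace Summit.QuantumFields.YangMills.Theorems.BrascampLiebVacuumSC

namespace DimensionGap

/-! ### Frobenius bookkeeping -/

/-- `froSq (−M) = froSq M`. [folklore] -/
theorem froSq_neg {N : ℕ} (M : Matrix (Fin N) (Fin N) ℂ) : froSq (-M) = froSq M := by
  unfold froSq
  simp [norm_neg]

/-- Right unitary invariance: `froSq (M A) = froSq M` for unitary `A` (cyclicity of the trace).
[folklore] -/
theorem froSq_mul_unitary {N : ℕ} (M : Matrix (Fin N) (Fin N) ℂ) {A : Matrix (Fin N) (Fin N) ℂ}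
    (hA : A ∈ Matrix.unitaryGroup (Fin N) ℂ) : froSq (M * A) = froSq M := by
  have hA' : A * Aᴴ = 1 := by
    rw [← Matrix.star_eq_conjTranspose]; exact Matrix.mem_unitaryGroup_iff.1 hA
  rw [GaugeAlgebra.froSq_eq_re_trace, GaugeAlgebra.froSq_eq_re_trace, Matrix.conjTranspose_mul,
    Matrix.mul_assoc, Matrix.trace_mul_comm, Matrix.mul_assoc, Matrix.mul_assoc, hA', Matrix.mul_one]

variable {G : Type} [Group G] [TopologicalSpace G]

/-- Bi-invariance of the Frobenius distance in the form the counting uses: if `‖ρ a − 1‖²_F < (ε/2)²` and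
`‖ρ b − 1‖²_F < (ε/2)²` then `‖ρ(a j b⁻¹) − ρ j‖²_F < ε²` (indeed `ρ(a j b⁻¹) − ρ j = (ρa − 1) ρ(j b⁻¹) + ρ j (ρ b⁻¹ − 1)`
and `froSq (X + Y) ≤ 2 froSq X + 2 froSq Y`). [folklore] -/
theorem froSq_conj_sub_lt (r : LatticeRep G) {ε : ℝ} {a b : G} (j : G)
    (ha : froSq (r.ρ a - 1) < (ε / 2) ^ 2) (hb : froSq (r.ρ b - 1) < (ε / 2) ^ 2) :
    froSq (r.ρ (a * j * b⁻¹) - r.ρ j) < ε ^ 2 := by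
  have hdec : r.ρ (a * j * b⁻¹) - r.ρ j =
      (r.ρ a - 1) * r.ρ (j * b⁻¹) + r.ρ j * (r.ρ b⁻¹ - 1) := by
    simp only [map_mul, sub_mul, mul_sub, one_mul, mul_one, Matrix.mul_assoc]
    abel
  have h1 : froSq ((r.ρ a - 1) * r.ρ (j * b⁻¹)) = froSq (r.ρ a - 1) :=
    froSq_mul_unitary _ (r.mem_unitary _)
  have h2 : froSq (r.ρ j * (r.ρ b⁻¹ - 1)) = froSq (r.ρ b - 1) := by
    rw [GaugeAlgebra.froSq_unitary_mul (r.mem_unitary j)]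
    have hb1 : r.ρ b⁻¹ - 1 = r.ρ b⁻¹ * (-(r.ρ b - 1)) := by
      rw [neg_sub, mul_sub, mul_one, ← map_mul, inv_mul_cancel, map_one]
    rw [hb1, GaugeAlgebra.froSq_unitary_mul (r.mem_unitary _), froSq_neg]
  calc froSq (r.ρ (a * j * b⁻¹) - r.ρ j)
      ≤ 2 * froSq ((r.ρ a - 1) * r.ρ (j * b⁻¹)) + 2 * froSq (r.ρ j * (r.ρ b⁻¹ - 1)) := by
        rw [hdec]; exact GaugeAlgebra.froSq_add_le _ _
    _ = 2 * froSq (r.ρ a - 1) + 2 * froSq (r.ρ b - 1) := by rw [h1, h2]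
    _ < 2 * (ε / 2) ^ 2 + 2 * (ε / 2) ^ 2 := by gcongr
    _ = ε ^ 2 := by ring

/-- A faithful continuous unitary matrix representation of a compact group makes it a topological group
(its topology is induced from `U(N)`, where multiplication and `star` are continuous). [folklore] -/
theorem isTopologicalGroup_of_latticeRep [CompactSpace G] (r : LatticeRep G) : IsTopologicalGroup G := by
  have hemb : Topology.IsEmbedding r.ρ := (r.continuous.isClosedEmbedding r.injective).isEmbedding
  have hmul : Continuous fun p : G × G => p.1 * p.2 := by
    rw [hemb.continuous_iff]
    have h : (r.ρ ∘ fun p : G × G => p.1 * p.2) = fun p => r.ρ p.1 * r.ρ p.2 := by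
      ext1 p; simp only [Function.comp_apply, map_mul]
    rw [h]
    exact (r.continuous.comp continuous_fst).mul (r.continuous.comp continuous_snd)
  have hinv : Continuous fun g : G => g⁻¹ := by
    rw [hemb.continuous_iff]
    have h : (r.ρ ∘ fun g : G => g⁻¹) = fun g => star (r.ρ g) := by
      ext1 g
      simp only [Function.comp_apply]
      have h1 : r.ρ g⁻¹ * r.ρ g = 1 := by rw [← map_mul, inv_mul_cancel, map_one]
      have h2 : star (r.ρ g) * r.ρ g = 1 := Matrix.mem_unitaryGroup_iff'.1 (r.mem_unitary g)
      exact (Matrix.inv_eq_left_inv h1).symm.trans (Matrix.inv_eq_left_inv h2)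
    rw [h]
    exact r.continuous.star
  exact @IsTopologicalGroup.mk G _ _ ⟨hmul⟩ ⟨hinv⟩

/-! ### Abstract Tonelli counting -/

section Counting

variable [IsTopologicalGroup G] [CompactSpace G] [MeasurableSpace G] [BorelSpace G]
  [SecondCountableTopology G]

/-- **Gauge saturation bound.** Let `src tgt : Λ → V` be the endpoints of finitely many links on finitely
many sites, `J ⊆ G` any set, `Jε ⊆ G` open and `A ⊆ G` with `a j b⁻¹ ∈ Jε` for `j ∈ J`, `a, b ∈ A`. If every
link field `w : Λ → G` is a gauge transform of a `J`-valued one (`k(src ℓ) w_ℓ k(tgt ℓ)⁻¹ ∈ J` for some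
`k : V → G`), then `μ(A)^{|V|} ≤ μ(Jε)^{|Λ|}` for the Haar probability measure `μ` — both sides compute the
`μ^V ⊗ μ^Λ`-measure of `{(k, w) : ∀ ℓ, k(src ℓ) w_ℓ k(tgt ℓ)⁻¹ ∈ Jε}` by Tonelli, in `k` first (two-sided
invariance: `= μ(Jε)^{|Λ|}`) and in `w` first (`≥ μ(A)^{|V|}`, the translated product of `A`'s around the
saturating gauge). [folklore] -/
theorem measure_pow_le_of_gaugeSaturation {V Λ : Type} [Fintype V] [Fintype Λ]
    (src tgt : Λ → V) {J Jε A : Set G} (hJε : IsOpen Jε)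
    (hAJ : ∀ j ∈ J, ∀ a ∈ A, ∀ b ∈ A, a * j * b⁻¹ ∈ Jε)
    (H : ∀ w : Λ → G, ∃ k : V → G, ∀ ℓ, k (src ℓ) * w ℓ * (k (tgt ℓ))⁻¹ ∈ J) :
    haarProbability G A ^ Fintype.card V ≤ haarProbability G Jε ^ Fintype.card Λ := by
  classical
  set μ : Measure G := haarProbability G with hμ
  set P : Measure (V → G) := Measure.pi fun _ => μ with hP
  set Q : Measure (Λ → G) := Measure.pi fun _ => μ with hQ
  -- the open set `T`
  set T : Set ((V → G) × (Λ → G)) :=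
    {p | ∀ ℓ, p.1 (src ℓ) * p.2 ℓ * (p.1 (tgt ℓ))⁻¹ ∈ Jε} with hT
  have hTopen : IsOpen T := by
    rw [hT, Set.setOf_forall]
    refine isOpen_iInter_of_finite fun ℓ => hJε.preimage ?_
    exact ((((continuous_apply (src ℓ)).comp continuous_fst).mul
      ((continuous_apply ℓ).comp continuous_snd)).mul
      (((continuous_apply (tgt ℓ)).comp continuous_fst).inv))
  have hTm : MeasurableSet T := hTopen.measurableSet
  -- Tonelli, `k` first: the fibres have measure `μ(Jε)^{|Λ|}`
  have h1 : (P.prod Q) T = μ Jε ^ Fintype.card Λ := by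
    rw [Measure.prod_apply hTm]
    have hfib : ∀ k : V → G, Q (Prod.mk k ⁻¹' T) = μ Jε ^ Fintype.card Λ := by
      intro k
      have hset : Prod.mk k ⁻¹' T = Set.univ.pi fun ℓ =>
          (fun g => k (src ℓ) * g) ⁻¹' ((fun g => g * (k (tgt ℓ))⁻¹) ⁻¹' Jε) := by
        ext w
        simp only [hT, Set.mem_preimage, Set.mem_setOf_eq, Set.mem_univ_pi]
      rw [hset, hQ, Measure.pi_pi]
      simp only [hμ, measure_preimage_mul, measure_preimage_mul_right, Finset.prod_const,
        Finset.card_univ]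
    simp only [hfib, lintegral_const, measure_univ, mul_one]
  -- Tonelli, `w` first: the fibres contain a translated product of `A`'s
  have h2 : μ A ^ Fintype.card V ≤ (P.prod Q) T := by
    rw [Measure.prod_apply_symm hTm]
    calc μ A ^ Fintype.card V = ∫⁻ _w, μ A ^ Fintype.card V ∂Q := by
          rw [lintegral_const, measure_univ, mul_one]
      _ ≤ ∫⁻ w, P ((fun k => (k, w)) ⁻¹' T) ∂Q := lintegral_mono fun w => ?_
    obtain ⟨k₀, hk₀⟩ := H w
    have hsub : (Set.univ.pi fun x => (fun g => g * (k₀ x)⁻¹) ⁻¹' A) ⊆ (fun k => (k, w)) ⁻¹' T := by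
      intro k hk
      simp only [Set.mem_preimage, hT, Set.mem_setOf_eq]
      intro ℓ
      have hs : k (src ℓ) * (k₀ (src ℓ))⁻¹ ∈ A := hk (src ℓ) (Set.mem_univ _)
      have ht : k (tgt ℓ) * (k₀ (tgt ℓ))⁻¹ ∈ A := hk (tgt ℓ) (Set.mem_univ _)
      have key := hAJ _ (hk₀ ℓ) _ hs _ ht
      have heq : k (src ℓ) * (k₀ (src ℓ))⁻¹ * (k₀ (src ℓ) * w ℓ * (k₀ (tgt ℓ))⁻¹) *
          (k (tgt ℓ) * (k₀ (tgt ℓ))⁻¹)⁻¹ = k (src ℓ) * w ℓ * (k (tgt ℓ))⁻¹ := by group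
      rw [heq] at key
      exact key
    calc μ A ^ Fintype.card V = P (Set.univ.pi fun x => (fun g => g * (k₀ x)⁻¹) ⁻¹' A) := by
          rw [hP, Measure.pi_pi]
          simp only [hμ, measure_preimage_mul_right, Finset.prod_const, Finset.card_univ]
      _ ≤ P ((fun k => (k, w)) ⁻¹' T) := measure_mono hsub
  exact h2.trans_eq h1

end Counting

/-! ### The cube: sites, valid links, and a lower bound on their number -/

/-- The cube of side `q + 1` has at least `3 q (q+1)²` valid links `{p : (Fin 3 → Fin (q+1)) × Fin 3 // p.1 p.2 + 1 < q + 1}`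
(inject `(j, t, y) ↦ (x, j)` with
`x j = t < q` and the other two coordinates `y`). [folklore] -/
theorem card_cubeLink_ge (q : ℕ) :
    3 * q * (q + 1) ^ 2 ≤ Fintype.card {p : (Fin 3 → Fin (q + 1)) × Fin 3 // (p.1 p.2 : ℕ) + 1 < q + 1} := by
  classical
  let f : Fin 3 × Fin q × (Fin 2 → Fin (q + 1)) → {p : (Fin 3 → Fin (q + 1)) × Fin 3 // (p.1 p.2 : ℕ) + 1 < q + 1} :=
    fun p =>
    ⟨(Fin.insertNth (α := fun _ => Fin (q + 1)) p.1 (Fin.castSucc p.2.1) p.2.2, p.1), by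
      show ((Fin.insertNth (α := fun _ => Fin (q + 1)) p.1 (Fin.castSucc p.2.1) p.2.2 p.1 :
        Fin (q + 1)) : ℕ) + 1 < q + 1
      rw [Fin.insertNth_apply_same, Fin.val_castSucc]
      have := p.2.1.isLt
      omega⟩
  have hf : Function.Injective f := by
    rintro ⟨j, t, y⟩ ⟨j', t', y'⟩ h
    have h' := congrArg Subtype.val h
    simp only [f, Prod.mk.injEq] at h'
    obtain ⟨hx, rfl⟩ := h'
    obtain ⟨ht, hy⟩ := Fin.insertNth_injective2 hx
    simp only [Fin.castSucc_inj] at ht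
    subst ht; subst hy; rfl
  have hcard := Fintype.card_le_of_injective f hf
  simpa [Fintype.card_prod, Fintype.card_fin, Fintype.card_fun, mul_comm, mul_assoc,
    mul_left_comm] using hcard

end DimensionGap

open DimensionGap

/-- **The cube witness from a Haar dimension gap** (`stub_cubeWitness` of skeleton v5 for every compact
group `G` with a faithful unitary `r` whose Haar probability measure `μ` satisfies, in the Frobenius distance
pulled back by `r.ρ`: ball growth `c ε^d ≤ μ{‖ρ g − 1‖ < ε}` and thin involutions
`μ{g : ∃ j, j² = 1, ‖ρ g − ρ j‖ < ε} ≤ C ε^m` for `0 < ε ≤ ε₀`, with `d < 3m`). Then for `n = d + 2` some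
configuration of the `n × n × n` cube is not a gauge transform of an involution-valued one: otherwise
`DimensionGap.measure_pow_le_of_gaugeSaturation` gives `(c (ε/2)^d)^{n³} ≤ (C ε^m)^{3 n²(n−1)}` for all
small `ε`, and `3m n²(n−1) > d n³`. [folklore] -/
theorem stub_cubeWitness_of_dimensionGap :
    ∀ (G : Type) [Group G] [TopologicalSpace G] [IsTopologicalGroup G] [CompactSpace G]
    [MeasurableSpace G] [BorelSpace G] (r : LatticeRep G) (d m : ℕ) (c C ε₀ : ℝ),
      d < 3 * m → 0 < c → 0 < ε₀ →
      (∀ ε : ℝ, 0 < ε → ε ≤ ε₀ →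
        c * ε ^ d ≤ (haarProbability G {g : G | froSq (r.ρ g - 1) < ε ^ 2}).toReal) →
      (∀ ε : ℝ, 0 < ε → ε ≤ ε₀ →
        (haarProbability G {g : G | ∃ j : G, j * j = 1 ∧ froSq (r.ρ g - r.ρ j) < ε ^ 2}).toReal
          ≤ C * ε ^ m) →
      ∃ (n : ℕ) (u : (Fin 3 → Fin n) → Fin 3 → G), ∀ k : (Fin 3 → Fin n) → G,
        ∃ (x : Fin 3 → Fin n) (j : Fin 3) (h : (x j : ℕ) + 1 < n),
          k x * u x j * (k (Function.update x j ⟨(x j : ℕ) + 1, h⟩))⁻¹ *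
            (k x * u x j * (k (Function.update x j ⟨(x j : ℕ) + 1, h⟩))⁻¹) ≠ 1 := by
  intro G _ _ _ _ _ _ r d m c C ε₀ hdm hc hε₀ hball hthin
  classical
  haveI : SecondCountableTopology G :=
    (r.continuous.isClosedEmbedding r.injective).isEmbedding.secondCountableTopology
  -- cube side `n = q + 1` with `q = d + 1`, so that `d (q + 1) < 3 m q`
  set q : ℕ := d + 1 with hq
  have hqd : d * (q + 1) < 3 * m * q := by
    rw [hq]
    have h3 : d + 1 ≤ 3 * m := hdm
    nlinarith
  refine ⟨q + 1, ?_⟩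
  by_contra hno
  push Not at hno
  -- valid links and their endpoints
  set Λ : Type := {p : (Fin 3 → Fin (q + 1)) × Fin 3 // (p.1 p.2 : ℕ) + 1 < q + 1} with hΛ
  set src : Λ → (Fin 3 → Fin (q + 1)) := fun ℓ => ℓ.1.1 with hsrc
  set tgt : Λ → (Fin 3 → Fin (q + 1)) := fun ℓ =>
    Function.update ℓ.1.1 ℓ.1.2 ⟨(ℓ.1.1 ℓ.1.2 : ℕ) + 1, ℓ.2⟩ with htgt
  -- every link field is a gauge transform of an involution-valued one
  have H : ∀ w : Λ → G, ∃ k : (Fin 3 → Fin (q + 1)) → G,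
      ∀ ℓ, k (src ℓ) * w ℓ * (k (tgt ℓ))⁻¹ ∈ {g : G | g * g = 1} := by
    intro w
    obtain ⟨k, hk⟩ := hno fun x j => if h : (x j : ℕ) + 1 < q + 1 then w ⟨(x, j), h⟩ else 1
    refine ⟨k, fun ℓ => ?_⟩
    have := hk ℓ.1.1 ℓ.1.2 ℓ.2
    simp only [dif_pos ℓ.2] at this
    exact this
  -- the counting at scale `ε`
  set μ : Measure G := haarProbability G with hμ
  set E : ℕ := 3 * q * (q + 1) ^ 2 with hE
  have hEcard : E ≤ Fintype.card Λ := card_cubeLink_ge q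
  have hVcard : Fintype.card (Fin 3 → Fin (q + 1)) = (q + 1) ^ 3 := by
    rw [Fintype.card_fun, Fintype.card_fin, Fintype.card_fin]
  set C' : ℝ := max C 1 with hC'
  have hC'1 : 1 ≤ C' := le_max_right _ _
  have key : ∀ ε : ℝ, 0 < ε → ε ≤ ε₀ →
      (c * (ε / 2) ^ d) ^ (q + 1) ^ 3 ≤ (C' * ε ^ m) ^ E := by
    intro ε hε hεε₀
    set A : Set G := {g : G | froSq (r.ρ g - 1) < (ε / 2) ^ 2} with hA
    set Jε : Set G := {g : G | ∃ j : G, j * j = 1 ∧ froSq (r.ρ g - r.ρ j) < ε ^ 2} with hJε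
    have hJopen : IsOpen Jε := by
      have hcont : ∀ j : G, Continuous fun g : G => froSq (r.ρ g - r.ρ j) := fun j =>
        Summit.QuantumFields.YangMills.Cruxes.CovarianceBound.SupportWindow.SupMeasurable.continuous_froSq.comp
          (r.continuous.sub continuous_const)
      have heq : Jε = ⋃ j ∈ {j : G | j * j = 1}, {g : G | froSq (r.ρ g - r.ρ j) < ε ^ 2} := by
        ext g
        simp only [hJε, Set.mem_setOf_eq, Set.mem_iUnion, exists_prop]
      rw [heq]
      exact isOpen_biUnion fun j _ => isOpen_lt (hcont j) continuous_const
    have hAJ : ∀ j ∈ {g : G | g * g = 1}, ∀ a ∈ A, ∀ b ∈ A, a * j * b⁻¹ ∈ Jε := by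
      intro j hj a ha b hb
      exact ⟨j, hj, froSq_conj_sub_lt r j ha hb⟩
    have hcount := measure_pow_le_of_gaugeSaturation src tgt hJopen hAJ H
    -- to real numbers
    have hfin : μ Jε ^ Fintype.card Λ ≠ ∞ :=
      ENNReal.pow_ne_top (measure_ne_top _ _)
    have hreal : (μ A).toReal ^ (q + 1) ^ 3 ≤ (μ Jε).toReal ^ Fintype.card Λ := by
      have := ENNReal.toReal_mono hfin hcount
      rwa [ENNReal.toReal_pow, ENNReal.toReal_pow, hVcard] at this
    have hJle1 : (μ Jε).toReal ≤ 1 := by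
      have : μ Jε ≤ 1 := prob_le_one
      exact ENNReal.toReal_le_of_le_ofReal zero_le_one (by simpa using this)
    have hJ0 : 0 ≤ (μ Jε).toReal := ENNReal.toReal_nonneg
    have hballε : c * (ε / 2) ^ d ≤ (μ A).toReal := hball (ε / 2) (by positivity) (by linarith)
    have hthinε : (μ Jε).toReal ≤ C' * ε ^ m :=
      (hthin ε hε hεε₀).trans (mul_le_mul_of_nonneg_right (le_max_left _ _) (by positivity))
    calc (c * (ε / 2) ^ d) ^ (q + 1) ^ 3
        ≤ (μ A).toReal ^ (q + 1) ^ 3 := pow_le_pow_left₀ (by positivity) hballε _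
      _ ≤ (μ Jε).toReal ^ Fintype.card Λ := hreal
      _ ≤ (μ Jε).toReal ^ E := pow_le_pow_of_le_one hJ0 hJle1 hEcard
      _ ≤ (C' * ε ^ m) ^ E := pow_le_pow_left₀ hJ0 hthinε _
  -- the exponents: `m E = d (q+1)³ + s` with `s ≥ 1`
  have hlt : d * (q + 1) ^ 3 < m * E := by
    rw [hE]
    have : d * (q + 1) ^ 3 = d * (q + 1) * (q + 1) ^ 2 := by ring
    rw [this]
    have : m * (3 * q * (q + 1) ^ 2) = 3 * m * q * (q + 1) ^ 2 := by ring
    rw [this]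
    exact Nat.mul_lt_mul_of_lt_of_le hqd le_rfl (by positivity)
  obtain ⟨s, hs⟩ := Nat.exists_eq_add_of_lt hlt
  -- constants
  set K : ℝ := c ^ (q + 1) ^ 3 / 2 ^ (d * (q + 1) ^ 3) with hKdef
  have hK : 0 < K := by positivity
  set M : ℝ := C' ^ E with hMdef
  have hM : 1 ≤ M := one_le_pow₀ hC'1
  have hM0 : 0 < M := by positivity
  -- the absurd scale
  set ε : ℝ := min (min ε₀ 1) (K / (2 * M)) with hεdef
  have hε : 0 < ε := by positivity
  have hεε₀ : ε ≤ ε₀ := (min_le_left _ _).trans (min_le_left _ _)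
  have hε1 : ε ≤ 1 := (min_le_left _ _).trans (min_le_right _ _)
  have hεK : ε ≤ K / (2 * M) := min_le_right _ _
  have hmain := key ε hε hεε₀
  have hL : (c * (ε / 2) ^ d) ^ (q + 1) ^ 3 = K * ε ^ (d * (q + 1) ^ 3) := by
    rw [hKdef, mul_pow, ← pow_mul, div_pow]
    ring
  have hR : (C' * ε ^ m) ^ E = M * ε ^ (s + 1) * ε ^ (d * (q + 1) ^ 3) := by
    have hexp : m * E = s + 1 + d * (q + 1) ^ 3 := by rw [hs]; ring
    rw [hMdef, mul_assoc, ← pow_add, mul_pow, show (ε ^ m) ^ E = ε ^ (m * E) from (pow_mul ε m E).symm,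
      hexp]
  rw [hL, hR] at hmain
  have hKle : K ≤ M * ε ^ (s + 1) := le_of_mul_le_mul_right hmain (by positivity)
  have hεs : ε ^ (s + 1) ≤ ε := by
    have := pow_le_pow_of_le_one hε.le hε1 (Nat.succ_le_succ (Nat.zero_le s))
    rwa [pow_one] at this
  have h2 : M * ε ^ (s + 1) ≤ K / 2 := by
    calc M * ε ^ (s + 1) ≤ M * ε := mul_le_mul_of_nonneg_left hεs hM0.le
      _ ≤ M * (K / (2 * M)) := mul_le_mul_of_nonneg_left hεK hM0.le
      _ = K / 2 := by field_simp
  linarith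

end Summit.QuantumFields.YangMills.Theorems.BrascampLiebVacuumSC

end
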